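import Summits.Parity.BatemanHorn.Theorems.AlmostPrimeZerosSystemZeroRepulsionReduction
import Summits.Parity.BatemanHorn.Theorems.AlmostPrimeZerosHadamardBookkeeping

/-!
# Crux `SystemZeroRepulsion` (stmt-Parity-11291): per-statistic reductions and the `Re z = 0` cut

Route `AlmostPrimeZeros`, crux `Summit.Parity.BatemanHorn.Theses.AlmostPrimeZeros.SystemZeroRepulsion`
(`T_f(x) := Σ_ρ ‖1 − ρ‖⁻² ≤ C_f`, the sum over the roots of the almost-prime polynomial
`S_x(z) = Σ_{0 ≤ n ≤ x} z^{s_f(n)}`); line `smooth-rough-lattice-acquisition`, reshaped by the fifth lead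
(c2, 2026-08-17) to the strategist's near/far split (`Cruxes/SystemZeroRepulsion/STRATEGY-CENSUS.md`).
Everything here is PROVED; `L = log log x`.

* `stub_repulsionStat` — **the two-hypothesis reduction for ONE exponent sequence** `s : ℕ → ℕ`:
  the one-sided disc majorant `‖Σ_{n≤x} z^{s(n)}‖ ≤ A x (log x)^{k(Re z−1)} e^{C‖z−1‖^{3/2}}` on
  `‖z − 1‖ ≤ 3L` (`x ≥ x₀`) and the wide moment `Σ_{n≤x} t^{s(n)} ≤ (x+1)e^{C(tL + t²/L)}`
  (`1 ≤ t ≤ √log x`, `x ≥ x₀`) give `Σ_ρ ‖1−ρ‖⁻² ≤ C'` over the roots of `Σ_{n≤x} X^{s(n)}` for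
  EVERY `x` (through the landed per-statistic zones `stub_nearZoneStat`, `stub_farZoneStat`).  The
  landed `Reduction.SystemZeroRepulsion_of_discMajorant_of_farMomentWide` is the same for all
  Bateman–Horn systems at once; the per-statistic form is what a class-by-class composition needs.
* `discMajorant_of_discMajorantLog_stat` — Γ-growth budget `e^{C‖z−1‖log(‖z−1‖+2)}` ⟹ `3/2`-budget,
  per statistic.
* `discMajorantLog_of_halves_stat` and `SystemZeroRepulsion_of_halves_of_farMomentWide` — the
  strategist's cut of the near leaf at `Re z = 0`: RightHalfDiscMajorant (`Re z ≥ 0`, twin-blind)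
  ∧ LeftHalfDiscDecay (`Re z < 0`, the parity content) ⟹ DiscMajorantLog, hence with FarMomentWide
  the crux by name (3-leaf glue; the evidence file `AlmostPrimeZerosSystemZeroRepulsionSplit.lean`
  of planner-cstrat-…-p1, transplanted).
* `twinExclusion` — for `P ∈ ℂ[z]` with `P(1) ≠ 0` and `‖P(−1)‖ = ‖P(1)‖`:
  `Re P′(1)/P(1) ≤ Σ_ρ ‖1−ρ‖⁻²` (Hadamard bookkeeping at `z = −1`).  The Selberg twin
  `E_x = S_x(z) + S_x(−z)` of a system is even with mean `≈ k L`, so `T(E_x) → ∞`: the crux is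
  violated by every parity twin, and the violation sits in the LEFT half-disc.
* `stub_repulsionOfTiltedStat` — **the radius-`L/C` reduction for ONE exponent sequence** (the
  composition `LinearCappedRepulsion_of_stubs` of crux `LinearCappedRepulsion`, over a general
  `s : ℕ → ℕ`): a tilted majorant `‖Σ z^{s(n)}‖ ≤ (x+1)exp(L(Re z−1) + A(1+‖z−1‖)^{3/2})` on the
  SMALLER disc `‖z−1‖ ≤ L/C` plus a Rankin moment `Σ y^{s(n)} ≤ (x+1)exp(ByL + By^{3/2})` for ALL
  `y ≥ 1` give the same conclusion — the form in which the calibration class `k = 1`, `f = X + h`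
  is reached from the landed `f = X` majorants.
-/

noncomputable section

namespace Summit.Parity.BatemanHorn.Cruxes.SystemZeroRepulsion.NearFar

open scoped BigOperators
open Summit.Parity.BatemanHorn.Theses.AlmostPrimeZeros
open Summit.Parity.BatemanHorn.Cruxes.SystemZeroRepulsion.SmoothRoughLatticeAcquisition
open Summit.Parity.BatemanHorn.Cruxes.SystemZeroRepulsion.Reduction
open Summit.Parity.BatemanHorn.Cruxes.LinearCappedRepulsion.JensenStieltjesMajorant

/-! ### The two-hypothesis reduction, per statistic -/

/-- **`T ≤ C` for one exponent sequence from its disc majorant and its wide moment** (registered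
helper stub `stub_repulsionStat` of the crux).  For `s : ℕ → ℕ`, `k : ℕ`: the one-sided disc
majorant `‖Σ_{n≤x} z^{s(n)}‖ ≤ A x (log x)^{k(Re z−1)} e^{C‖z−1‖^{3/2}}` on `‖z − 1‖ ≤ 3 log log x`
for `x ≥ x₀`, and the wide moment `Σ_{n≤x} t^{s(n)} ≤ (x+1) e^{C(t log log x + t²/log log x)}` for
`x ≥ x₀`, `x ≥ 3`, `1 ≤ t ≤ √log x`, imply that `Σ_ρ ‖1−ρ‖⁻²` over the roots (with multiplicity) of
`Σ_{n≤x} X^{s(n)}` is bounded by one constant for all `x`.  Proof: near zone (`‖1−ρ‖ < log log x`,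
`stub_nearZoneStat`) + far zone (`stub_farZoneStat`) from `max x₀ x₀' 64` on; the finitely many
earlier values are absorbed (`bounded_of_eventually_bounded`). -/
theorem stub_repulsionStat :
    ∀ (s : ℕ → ℕ) (k : ℕ),
      (∃ A C : ℝ, ∃ x₀ : ℕ, ∀ x : ℕ, x₀ ≤ x → ∀ z : ℂ, ‖z - 1‖ ≤ 3 * Real.log (Real.log (x : ℝ)) →
        ‖∑ n ∈ Finset.range (x + 1), z ^ (s n)‖ ≤
          A * (x : ℝ) * (Real.log (x : ℝ)) ^ ((k : ℝ) * (z.re - 1)) * Real.exp (C * ‖z - 1‖ ^ (3 / 2 : ℝ))) →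
      (∃ C : ℝ, ∃ x₀ : ℕ, ∀ x : ℕ, x₀ ≤ x → 3 ≤ x → ∀ t : ℝ, 1 ≤ t → t ≤ Real.sqrt (Real.log (x : ℝ)) →
        ∑ n ∈ Finset.range (x + 1), t ^ (s n) ≤
          ((x : ℝ) + 1) * Real.exp (C * (t * Real.log (Real.log (x : ℝ)) + t ^ 2 / Real.log (Real.log (x : ℝ))))) →
      ∃ C : ℝ, ∀ x : ℕ,
        ((∑ n ∈ Finset.range (x + 1), (Polynomial.X : Polynomial ℂ) ^ (s n)).roots.map
          (fun ρ : ℂ => (‖(1 : ℂ) - ρ‖ ^ 2)⁻¹)).sum ≤ C := by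
  intro s k hdisc hmom
  obtain ⟨A, C, x₀, hA⟩ := hdisc
  obtain ⟨C₁, x₁, hC₁⟩ := hmom
  obtain ⟨K, hK⟩ := stub_nearZoneStat s k A C x₀ hA
  have hfar := stub_farZoneStat s C₁ x₁ hC₁
  have hT0 : ∀ x : ℕ, 0 ≤ (((∑ n ∈ Finset.range (x + 1), (Polynomial.X : Polynomial ℂ) ^ (s n)).roots.map
      (fun ρ : ℂ => (‖(1 : ℂ) - ρ‖ ^ 2)⁻¹)).sum) := fun x => zoneSum_nonneg _
  exact bounded_of_eventually_bounded hT0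
    (B := K + (4 * ((1 + Real.exp 1) * max C₁ 0) + 8 * ((1 + Real.exp 1) ^ 2 * max C₁ 0) +
      16 * Real.exp 1 ^ 2 * (4 + 4 * max C₁ 0))) (x₀ := max (max x₀ 16) (max x₁ 64))
    (fun x hx => by
      rw [zoneSplit _ (Real.log (Real.log (x : ℝ)))]
      exact add_le_add (hK x (le_of_max_le_left hx)) (hfar x (le_of_max_le_right hx)))

/-! ### The Γ-growth form of the disc majorant, per statistic -/

/-- `log (r + 2) ≤ 2 √r + 1` for `r ≥ 0`. -/
private theorem log_add_two_le {r : ℝ} (hr : 0 ≤ r) : Real.log (r + 2) ≤ 2 * Real.sqrt r + 1 := by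
  -- adapted from Theorems/AlmostPrimeZerosSystemZeroRepulsionReduction.lean
  have h2 : (0 : ℝ) < r + 2 := by linarith
  have h1 : Real.log (r + 2) = 2 * Real.log (Real.sqrt (r + 2)) := by
    rw [Real.log_sqrt h2.le]; ring
  have h3 : Real.log (Real.sqrt (r + 2)) ≤ Real.sqrt (r + 2) - 1 :=
    Real.log_le_sub_one_of_pos (Real.sqrt_pos.2 h2)
  have h4 : Real.sqrt (r + 2) ≤ Real.sqrt r + 3 / 2 := by
    rw [Real.sqrt_le_left (by positivity)]
    nlinarith [Real.sq_sqrt hr, Real.sqrt_nonneg r]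
  linarith

/-- `r log (r + 2) ≤ 3 r^{3/2} + 1` for `r ≥ 0`. -/
private theorem mul_log_le_rpow {r : ℝ} (hr : 0 ≤ r) :
    r * Real.log (r + 2) ≤ 3 * r ^ (3 / 2 : ℝ) + 1 := by
  -- adapted from Theorems/AlmostPrimeZerosSystemZeroRepulsionReduction.lean
  have hrp : r ^ (3 / 2 : ℝ) = r * Real.sqrt r := by
    rw [show (3 / 2 : ℝ) = 1 + 1 / 2 by norm_num, Real.rpow_add' hr (by norm_num), Real.rpow_one,
      Real.sqrt_eq_rpow]
  rw [hrp]
  have h1 : r * Real.log (r + 2) ≤ r * (2 * Real.sqrt r + 1) :=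
    mul_le_mul_of_nonneg_left (log_add_two_le hr) hr
  have h2 : r ≤ r * Real.sqrt r + 1 := by
    rcases le_or_gt r 1 with h | h
    · nlinarith [mul_nonneg hr (Real.sqrt_nonneg r)]
    · have hs : 1 ≤ Real.sqrt r := by
        rw [show (1 : ℝ) = Real.sqrt 1 by simp]
        exact Real.sqrt_le_sqrt h.le
      nlinarith
  nlinarith [mul_nonneg hr (Real.sqrt_nonneg r)]

/-- **Γ-growth form ⟹ `3/2`-form, per statistic.**  A disc majorant with budget
`e^{C‖z−1‖ log(‖z−1‖+2)}` on `‖z − 1‖ ≤ 3 log log x` (`x ≥ x₀`) implies the one with budget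
`e^{C'‖z−1‖^{3/2}}` from `max x₀ 2` on (`A' = max A 0 · e^{C⁺}`, `C' = 3C⁺`, `C⁺ = max C 0`). -/
theorem discMajorant_of_discMajorantLog_stat (s : ℕ → ℕ) (k : ℕ) :
    (∃ A C : ℝ, ∃ x₀ : ℕ, ∀ x : ℕ, x₀ ≤ x → ∀ z : ℂ, ‖z - 1‖ ≤ 3 * Real.log (Real.log (x : ℝ)) →
        ‖∑ n ∈ Finset.range (x + 1), z ^ (s n)‖ ≤
          A * (x : ℝ) * (Real.log (x : ℝ)) ^ ((k : ℝ) * (z.re - 1)) *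
            Real.exp (C * ‖z - 1‖ * Real.log (‖z - 1‖ + 2))) →
    ∃ A C : ℝ, ∃ x₀ : ℕ, ∀ x : ℕ, x₀ ≤ x → ∀ z : ℂ, ‖z - 1‖ ≤ 3 * Real.log (Real.log (x : ℝ)) →
        ‖∑ n ∈ Finset.range (x + 1), z ^ (s n)‖ ≤
          A * (x : ℝ) * (Real.log (x : ℝ)) ^ ((k : ℝ) * (z.re - 1)) * Real.exp (C * ‖z - 1‖ ^ (3 / 2 : ℝ)) := by
  -- adapted from `Reduction.discMajorant_of_discMajorantLog`
  rintro ⟨A, C, x₀, h⟩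
  refine ⟨max A 0 * Real.exp (max C 0), 3 * max C 0, max x₀ 2, fun x hx z hz => ?_⟩
  have hx₀ : x₀ ≤ x := le_of_max_le_left hx
  have hx2 : (2 : ℝ) ≤ x := by exact_mod_cast le_of_max_le_right hx
  have hlogx : 0 < Real.log (x : ℝ) := Real.log_pos (by linarith)
  set r : ℝ := ‖z - 1‖ with hr
  have hr0 : 0 ≤ r := norm_nonneg _
  set P : ℝ := (x : ℝ) * (Real.log (x : ℝ)) ^ ((k : ℝ) * (z.re - 1)) with hP
  have hP0 : 0 ≤ P := mul_nonneg (by positivity) (Real.rpow_nonneg hlogx.le _)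
  have hrl : 0 ≤ r * Real.log (r + 2) := mul_nonneg hr0 (Real.log_nonneg (by linarith))
  have hexp : C * r * Real.log (r + 2) ≤ max C 0 + 3 * max C 0 * r ^ (3 / 2 : ℝ) := by
    have h1 : C * r * Real.log (r + 2) ≤ max C 0 * (r * Real.log (r + 2)) := by
      rw [mul_assoc]; exact mul_le_mul_of_nonneg_right (le_max_left C 0) hrl
    have h2 : max C 0 * (r * Real.log (r + 2)) ≤ max C 0 * (3 * r ^ (3 / 2 : ℝ) + 1) :=
      mul_le_mul_of_nonneg_left (mul_log_le_rpow hr0) (le_max_right C 0)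
    nlinarith
  calc ‖∑ n ∈ Finset.range (x + 1), z ^ (s n)‖
      ≤ A * (x : ℝ) * (Real.log (x : ℝ)) ^ ((k : ℝ) * (z.re - 1)) *
          Real.exp (C * ‖z - 1‖ * Real.log (‖z - 1‖ + 2)) := h x hx₀ z hz
    _ = A * (P * Real.exp (C * r * Real.log (r + 2))) := by rw [hP, hr]; ring
    _ ≤ max A 0 * (P * Real.exp (C * r * Real.log (r + 2))) :=
        mul_le_mul_of_nonneg_right (le_max_left A 0) (by positivity)
    _ ≤ max A 0 * (P * Real.exp (max C 0 + 3 * max C 0 * r ^ (3 / 2 : ℝ))) :=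
        mul_le_mul_of_nonneg_left (mul_le_mul_of_nonneg_left (Real.exp_le_exp.2 hexp) hP0)
          (le_max_right A 0)
    _ = max A 0 * Real.exp (max C 0) * (x : ℝ) * (Real.log (x : ℝ)) ^ ((k : ℝ) * (z.re - 1)) *
          Real.exp (3 * max C 0 * ‖z - 1‖ ^ (3 / 2 : ℝ)) := by
        rw [Real.exp_add, hP, hr]; ring

/-- **Two-hypothesis reduction with the Γ-growth disc majorant, per statistic**: the disc
majorant in the form the LSD heuristic predicts (budget `e^{C‖z−1‖log(‖z−1‖+2)}` on
`‖z−1‖ ≤ 3 log log x`) and the wide moment give `Σ_ρ ‖1−ρ‖⁻² ≤ C'` for all `x`. -/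
theorem repulsionStat_of_discMajorantLog_of_moment (s : ℕ → ℕ) (k : ℕ)
    (hdisc : ∃ A C : ℝ, ∃ x₀ : ℕ, ∀ x : ℕ, x₀ ≤ x → ∀ z : ℂ, ‖z - 1‖ ≤ 3 * Real.log (Real.log (x : ℝ)) →
        ‖∑ n ∈ Finset.range (x + 1), z ^ (s n)‖ ≤
          A * (x : ℝ) * (Real.log (x : ℝ)) ^ ((k : ℝ) * (z.re - 1)) *
            Real.exp (C * ‖z - 1‖ * Real.log (‖z - 1‖ + 2)))
    (hmom : ∃ C : ℝ, ∃ x₀ : ℕ, ∀ x : ℕ, x₀ ≤ x → 3 ≤ x → ∀ t : ℝ, 1 ≤ t → t ≤ Real.sqrt (Real.log (x : ℝ)) →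
        ∑ n ∈ Finset.range (x + 1), t ^ (s n) ≤
          ((x : ℝ) + 1) * Real.exp (C * (t * Real.log (Real.log (x : ℝ)) + t ^ 2 / Real.log (Real.log (x : ℝ))))) :
    ∃ C : ℝ, ∀ x : ℕ,
        ((∑ n ∈ Finset.range (x + 1), (Polynomial.X : Polynomial ℂ) ^ (s n)).roots.map
          (fun ρ : ℂ => (‖(1 : ℂ) - ρ‖ ^ 2)⁻¹)).sum ≤ C :=
  stub_repulsionStat s k (discMajorant_of_discMajorantLog_stat s k hdisc) hmom

/-! ### The cut of the near leaf at `Re z = 0` -/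

/-- **RightHalfDiscMajorant ∧ LeftHalfDiscDecay ⟹ DiscMajorantLog, per statistic.**  If the
Γ-growth majorant `‖Σ_{n≤x} z^{s(n)}‖ ≤ A x (log x)^{k(Re z−1)} e^{C‖z−1‖log(‖z−1‖+2)}` holds on the
right half `{‖z−1‖ ≤ 3 log log x, Re z ≥ 0}` of the growing disc (constants `A₁, C₁, x₁`) and on its
left half `{‖z−1‖ ≤ 3 log log x, Re z < 0}` (constants `A₂, C₂, x₂`), it holds on the whole disc with
`A = max (max A₁ A₂) 0`, `C = max (max C₁ C₂) 0`, from `max (max x₁ x₂) 2` on. -/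
theorem discMajorantLog_of_halves_stat (s : ℕ → ℕ) (k : ℕ)
    (hright : ∃ A C : ℝ, ∃ x₀ : ℕ, ∀ x : ℕ, x₀ ≤ x → ∀ z : ℂ, ‖z - 1‖ ≤ 3 * Real.log (Real.log (x : ℝ)) →
        0 ≤ z.re →
        ‖∑ n ∈ Finset.range (x + 1), z ^ (s n)‖ ≤
          A * (x : ℝ) * (Real.log (x : ℝ)) ^ ((k : ℝ) * (z.re - 1)) *
            Real.exp (C * ‖z - 1‖ * Real.log (‖z - 1‖ + 2)))
    (hleft : ∃ A C : ℝ, ∃ x₀ : ℕ, ∀ x : ℕ, x₀ ≤ x → ∀ z : ℂ, ‖z - 1‖ ≤ 3 * Real.log (Real.log (x : ℝ)) →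
        z.re < 0 →
        ‖∑ n ∈ Finset.range (x + 1), z ^ (s n)‖ ≤
          A * (x : ℝ) * (Real.log (x : ℝ)) ^ ((k : ℝ) * (z.re - 1)) *
            Real.exp (C * ‖z - 1‖ * Real.log (‖z - 1‖ + 2))) :
    ∃ A C : ℝ, ∃ x₀ : ℕ, ∀ x : ℕ, x₀ ≤ x → ∀ z : ℂ, ‖z - 1‖ ≤ 3 * Real.log (Real.log (x : ℝ)) →
        ‖∑ n ∈ Finset.range (x + 1), z ^ (s n)‖ ≤
          A * (x : ℝ) * (Real.log (x : ℝ)) ^ ((k : ℝ) * (z.re - 1)) *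
            Real.exp (C * ‖z - 1‖ * Real.log (‖z - 1‖ + 2)) := by
  obtain ⟨A₁, C₁, x₁, h₁⟩ := hright
  obtain ⟨A₂, C₂, x₂, h₂⟩ := hleft
  refine ⟨max (max A₁ A₂) 0, max (max C₁ C₂) 0, max (max x₁ x₂) 2, fun x hx z hz => ?_⟩
  have hx₁ : x₁ ≤ x := le_trans (le_max_left _ _) (le_of_max_le_left hx)
  have hx₂ : x₂ ≤ x := le_trans (le_max_right _ _) (le_of_max_le_left hx)
  have hx2 : (2 : ℝ) ≤ x := by exact_mod_cast le_of_max_le_right hx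
  have hlogx : 0 < Real.log (x : ℝ) := Real.log_pos (by linarith)
  set r : ℝ := ‖z - 1‖ with hr
  have hr0 : 0 ≤ r := norm_nonneg _
  have hrl : 0 ≤ r * Real.log (r + 2) := mul_nonneg hr0 (Real.log_nonneg (by linarith))
  set P : ℝ := (x : ℝ) * (Real.log (x : ℝ)) ^ ((k : ℝ) * (z.re - 1)) with hP
  have hP0 : 0 ≤ P := mul_nonneg (by positivity) (Real.rpow_nonneg hlogx.le _)
  -- a bound with constants `(A', C')` improves to the `max`-constants
  have hmono : ∀ A' C' : ℝ, A' ≤ max (max A₁ A₂) 0 → C' ≤ max (max C₁ C₂) 0 →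
      A' * (x : ℝ) * (Real.log (x : ℝ)) ^ ((k : ℝ) * (z.re - 1)) * Real.exp (C' * ‖z - 1‖ * Real.log (‖z - 1‖ + 2)) ≤
        max (max A₁ A₂) 0 * (x : ℝ) * (Real.log (x : ℝ)) ^ ((k : ℝ) * (z.re - 1)) *
          Real.exp (max (max C₁ C₂) 0 * ‖z - 1‖ * Real.log (‖z - 1‖ + 2)) := by
    intro A' C' hA' hC'
    have hE : Real.exp (C' * ‖z - 1‖ * Real.log (‖z - 1‖ + 2)) ≤
        Real.exp (max (max C₁ C₂) 0 * ‖z - 1‖ * Real.log (‖z - 1‖ + 2)) := by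
      refine Real.exp_le_exp.2 ?_
      rw [← hr, mul_assoc, mul_assoc]
      exact mul_le_mul_of_nonneg_right hC' hrl
    calc A' * (x : ℝ) * (Real.log (x : ℝ)) ^ ((k : ℝ) * (z.re - 1)) * Real.exp (C' * ‖z - 1‖ * Real.log (‖z - 1‖ + 2))
        = A' * (P * Real.exp (C' * ‖z - 1‖ * Real.log (‖z - 1‖ + 2))) := by rw [hP]; ring
      _ ≤ max (max A₁ A₂) 0 * (P * Real.exp (C' * ‖z - 1‖ * Real.log (‖z - 1‖ + 2))) :=
          mul_le_mul_of_nonneg_right hA' (by positivity)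
      _ ≤ max (max A₁ A₂) 0 * (P * Real.exp (max (max C₁ C₂) 0 * ‖z - 1‖ * Real.log (‖z - 1‖ + 2))) :=
          mul_le_mul_of_nonneg_left (mul_le_mul_of_nonneg_left hE hP0) (le_max_right _ _)
      _ = _ := by rw [hP]; ring
  rcases le_or_gt 0 z.re with hre | hre
  · exact (h₁ x hx₁ z hz hre).trans
      (hmono A₁ C₁ ((le_max_left _ _).trans (le_max_left _ _)) ((le_max_left _ _).trans (le_max_left _ _)))
  · exact (h₂ x hx₂ z hz hre).trans
      (hmono A₂ C₂ ((le_max_right _ _).trans (le_max_left _ _)) ((le_max_right _ _).trans (le_max_left _ _)))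

/-- **The 3-leaf glue `RightHalfDiscMajorant → LeftHalfDiscDecay → FarMomentWide → SystemZeroRepulsion`**
(strategist split of the near leaf `DiscMajorantLog` at `Re z = 0`; concludes the route decl BY NAME).
The right half-disc majorant is parity-blind in Selberg's sense (Halász-type decay along the system);
the left half-disc decay is the tilted Liouville/Elliott cancellation along the system — the crux's
parity content (`twinExclusion`, and `liouvilleSaving_of_discMajorant`, p96296). -/
theorem SystemZeroRepulsion_of_halves_of_farMomentWide :
    (∀ (k : ℕ) (f : Fin k → Polynomial ℤ), Literature.NumberTheory.Sieve.IsBatemanHornSystem f →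
      ∃ A C : ℝ, ∃ x₀ : ℕ, ∀ x : ℕ, x₀ ≤ x → ∀ z : ℂ, ‖z - 1‖ ≤ 3 * Real.log (Real.log (x : ℝ)) →
        0 ≤ z.re →
        ‖(∑ n ∈ Finset.range (x + 1), (z : ℂ) ^ (∑ i, (((f i).eval (n : ℤ)).toNat.factorization.sum fun _ v => min v 2)))‖ ≤
          A * (x : ℝ) * (Real.log (x : ℝ)) ^ ((k : ℝ) * ((z : ℂ).re - 1)) *
            Real.exp (C * ‖(z : ℂ) - 1‖ * Real.log (‖(z : ℂ) - 1‖ + 2))) →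
    (∀ (k : ℕ) (f : Fin k → Polynomial ℤ), Literature.NumberTheory.Sieve.IsBatemanHornSystem f →
      ∃ A C : ℝ, ∃ x₀ : ℕ, ∀ x : ℕ, x₀ ≤ x → ∀ z : ℂ, ‖z - 1‖ ≤ 3 * Real.log (Real.log (x : ℝ)) →
        z.re < 0 →
        ‖(∑ n ∈ Finset.range (x + 1), (z : ℂ) ^ (∑ i, (((f i).eval (n : ℤ)).toNat.factorization.sum fun _ v => min v 2)))‖ ≤
          A * (x : ℝ) * (Real.log (x : ℝ)) ^ ((k : ℝ) * ((z : ℂ).re - 1)) *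
            Real.exp (C * ‖(z : ℂ) - 1‖ * Real.log (‖(z : ℂ) - 1‖ + 2))) →
    (∀ (k : ℕ) (f : Fin k → Polynomial ℤ), Literature.NumberTheory.Sieve.IsBatemanHornSystem f →
      ∃ C : ℝ, ∀ x : ℕ, 3 ≤ x → ∀ t : ℝ, 1 ≤ t → t ≤ Real.sqrt (Real.log (x : ℝ)) →
        (∑ n ∈ Finset.range (x + 1), (t : ℝ) ^ (∑ i, (((f i).eval (n : ℤ)).toNat.factorization.sum fun _ v => min v 2))) ≤
          ((x : ℝ) + 1) * Real.exp (C * (t * Real.log (Real.log (x : ℝ)) + t ^ 2 / Real.log (Real.log (x : ℝ))))) →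
    Summit.Parity.BatemanHorn.Theses.AlmostPrimeZeros.SystemZeroRepulsion :=
  fun hright hleft hfar =>
    SystemZeroRepulsion_of_discMajorantLog_of_farMomentWide
      (fun k f hf => discMajorantLog_of_halves_stat
        (fun n => ∑ i, (((f i).eval (n : ℤ)).toNat.factorization.sum fun _ v => min v 2)) k
        (hright k f hf) (hleft k f hf)) hfar

/-- **Twin exclusion** (the parity line is `Re z = 0`).  For every complex polynomial `P` with
`P(1) ≠ 0` whose values at `±1` have the same modulus, `Re P′(1)/P(1) ≤ Σ_ρ ‖1 − ρ‖⁻²` (roots with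
multiplicity).  Proof: Hadamard bookkeeping (landed route item `HadamardBookkeeping`) at `z = −1`
reads `‖P(−1)‖ ≤ ‖P(1)‖·exp(−2 Re P′(1)/P(1) + 2 Σ_ρ ‖1−ρ‖⁻²)`; divide by `‖P(1)‖ = ‖P(−1)‖ > 0`
and take logarithms.  Consequence: the Selberg twin `E_x(z) = S_x(z) + S_x(−z)` of a system (even,
positive coefficients, mean `≈ k log log x`) has `T(E_x) ≥ k log log x − O(1) → ∞` — any majorant
hypothesis that `E_x` also satisfies (it satisfies the right half-disc one up to constants) cannot
imply the crux. -/
theorem twinExclusion (P : Polynomial ℂ) (hP1 : P.eval 1 ≠ 0) (htwin : ‖P.eval (-1)‖ = ‖P.eval 1‖) :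
    ((Polynomial.derivative P).eval 1 / P.eval 1).re ≤
      (P.roots.map (fun ρ : ℂ => (‖(1 : ℂ) - ρ‖ ^ 2)⁻¹)).sum := by
  have h := Summit.Parity.BatemanHorn.Theorems.hadamardBookkeeping_proof P hP1 (-1)
  set T : ℝ := (P.roots.map (fun ρ : ℂ => (‖(1 : ℂ) - ρ‖ ^ 2)⁻¹)).sum with hT
  set μ : ℂ := (Polynomial.derivative P).eval 1 / P.eval 1 with hμ
  have hpos : 0 < ‖P.eval 1‖ := norm_pos_iff.2 hP1
  -- the exponent at `z = -1` is `-2 Re μ + 2 T`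
  have e1 : (1 : ℂ) - -1 = 2 := by norm_num
  have hre : ((1 - -1 : ℂ) * μ).re = 2 * μ.re := by
    rw [e1, Complex.mul_re]
    norm_num
  have hn : ‖(1 : ℂ) - -1‖ ^ 2 = 4 := by
    rw [e1, Complex.norm_two]
    norm_num
  rw [hre, hn, htwin] at h
  -- `‖P 1‖ ≤ ‖P 1‖ exp(-2 Re μ + 2 T)` forces `0 ≤ -2 Re μ + 2 T`
  have h1 : (1 : ℝ) ≤ Real.exp (-(2 * μ.re) + 1 / 2 * 4 * T) := by
    refine le_of_mul_le_mul_left ?_ hpos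
    simpa using h
  have h0 : (0 : ℝ) ≤ -(2 * μ.re) + 1 / 2 * 4 * T :=
    Real.exp_le_exp.1 (by rw [Real.exp_zero]; exact h1)
  linarith

/-! ### The radius-`L/C` reduction, per statistic -/

/-- **`T ≤ C` for one exponent sequence from a tilted majorant on the disc `‖z−1‖ ≤ log log x / C`
and a Rankin moment for all `y ≥ 1`** (registered helper stub `stub_repulsionOfTiltedStat`; the
composition `LinearCappedRepulsion_of_stubs` of crux `LinearCappedRepulsion` over a general exponent
sequence `s : ℕ → ℕ`, with the landed `stub_jensenCount` and `stub_stieltjes`).  Bookkeeping: for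
`x ≥ X := max x₀ (max 3 ⌈exp(exp C)⌉)` one has `L := log log x ≥ C > 0`; Jensen at the free centre
`1` with `Λ := L`, `Λ' := B·L`, `R₁ := L/C ≥ 1`, the global majorant coming from the Rankin moment at
`y := 1 + ‖z − 1‖ ≥ ‖z‖`; Stieltjes with `K₀ := C + B·C`, `r₀ := e^{−3A}`; the finitely many `x < X`
are absorbed. -/
theorem stub_repulsionOfTiltedStat :
    ∀ (s : ℕ → ℕ),
      (∃ A : ℝ, 0 ≤ A ∧ ∃ C : ℝ, 0 < C ∧ ∃ x₀ : ℕ, ∀ x : ℕ, x₀ ≤ x → ∀ z : ℂ,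
        ‖z - 1‖ ≤ Real.log (Real.log x) / C →
        ‖∑ n ∈ Finset.range (x + 1), z ^ (s n)‖ ≤
          ((x : ℝ) + 1) * Real.exp (Real.log (Real.log x) * (z.re - 1) + A * (1 + ‖z - 1‖) ^ (3 / 2 : ℝ))) →
      (∃ B : ℝ, 0 ≤ B ∧ ∀ x : ℕ, 3 ≤ x → ∀ y : ℝ, 1 ≤ y →
        ∑ n ∈ Finset.range (x + 1), y ^ (s n) ≤
          ((x : ℝ) + 1) * Real.exp (B * y * Real.log (Real.log x) + B * y ^ (3 / 2 : ℝ))) →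
      ∃ C : ℝ, ∀ x : ℕ,
        ((∑ n ∈ Finset.range (x + 1), (Polynomial.X : Polynomial ℂ) ^ (s n)).roots.map
          (fun ρ : ℂ => (‖(1 : ℂ) - ρ‖ ^ 2)⁻¹)).sum ≤ C := by
  -- adapted from `LinearCappedRepulsion_of_stubs`
  -- (Theorems/AlmostPrimeZerosLinearCappedRepulsionComposition.lean)
  intro s hTilt hRankin
  obtain ⟨A, hA0, C, hC, x₀, hmaj⟩ := hTilt
  obtain ⟨B, hB0, hrank⟩ := hRankin
  have hK₀ : (0 : ℝ) ≤ C + B * C := add_nonneg hC.le (mul_nonneg hB0 hC.le)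
  have hr₀ : (0 : ℝ) < Real.exp (-(3 * A)) := Real.exp_pos _
  obtain ⟨K, hK⟩ := stub_stieltjes A B (C + B * C) (Real.exp (-(3 * A))) hA0 hB0 hK₀ hr₀
  set X : ℕ := max x₀ (max 3 ⌈Real.exp (Real.exp C)⌉₊) with hXdef
  have main : ∀ x : ℕ, X ≤ x →
      ((∑ n ∈ Finset.range (x + 1), (Polynomial.X : Polynomial ℂ) ^ (s n)).roots.map
          (fun ρ : ℂ => (‖(1 : ℂ) - ρ‖ ^ 2)⁻¹)).sum ≤ K := by
    intro x hx
    have hx₀ : x₀ ≤ x := le_trans (le_max_left _ _) hx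
    have hx3 : 3 ≤ x := le_trans ((le_max_left _ _).trans (le_max_right _ _)) hx
    have hxceil : ⌈Real.exp (Real.exp C)⌉₊ ≤ x :=
      le_trans ((le_max_right _ _).trans (le_max_right _ _)) hx
    have hxexp : Real.exp (Real.exp C) ≤ (x : ℝ) :=
      (Nat.le_ceil _).trans (by exact_mod_cast hxceil)
    have hxpos : (0 : ℝ) < x := (Real.exp_pos _).trans_le hxexp
    have hlogx : Real.exp C ≤ Real.log x := (Real.le_log_iff_exp_le hxpos).2 hxexp
    have hlogpos : 0 < Real.log (x : ℝ) := (Real.exp_pos _).trans_le hlogx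
    have hCL : C ≤ Real.log (Real.log x) := (Real.le_log_iff_exp_le hlogpos).2 hlogx
    have hLpos : 0 < Real.log (Real.log x) := hC.trans_le hCL
    have hR₁ : 1 ≤ Real.log (Real.log x) / C := by
      rw [le_div_iff₀ hC]; simpa using hCL
    set P : Polynomial ℂ := ∑ n ∈ Finset.range (x + 1), (Polynomial.X : Polynomial ℂ) ^ (s n)
      with hPdef
    have hevalz : ∀ z : ℂ, P.eval z = ∑ n ∈ Finset.range (x + 1), z ^ (s n) := by
      intro z; simp [hPdef, Polynomial.eval_finsetSum]
    have heval1 : P.eval 1 = ((x + 1 : ℕ) : ℂ) := by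
      simp [hPdef, Polynomial.eval_finsetSum]
    have hnorm1 : ‖P.eval 1‖ = (x : ℝ) + 1 := by
      rw [heval1, Complex.norm_natCast]; push_cast; ring
    have hP1 : P.eval 1 ≠ 0 := by
      rw [heval1]; exact Nat.cast_ne_zero.2 (Nat.succ_ne_zero x)
    -- disc majorant
    have hdisc : ∀ z : ℂ, ‖z - 1‖ ≤ Real.log (Real.log x) / C →
        ‖P.eval z‖ ≤ ‖P.eval 1‖ * Real.exp (Real.log (Real.log x) * (z.re - 1) +
          A * (1 + ‖z - 1‖) ^ (3 / 2 : ℝ)) := by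
      intro z hz
      rw [hevalz, hnorm1]
      exact hmaj x hx₀ z hz
    -- global majorant from the Rankin moment and positivity
    have hglob : ∀ z : ℂ, ‖P.eval z‖ ≤ ‖P.eval 1‖ *
        Real.exp (B * Real.log (Real.log x) * (1 + ‖z - 1‖) + B * (1 + ‖z - 1‖) ^ (3 / 2 : ℝ)) := by
      intro z
      have hz1 : ‖z‖ ≤ 1 + ‖z - 1‖ := by
        have h := norm_add_le (z - 1) 1
        simp at h
        linarith
      have hy : (1 : ℝ) ≤ 1 + ‖z - 1‖ := by linarith [norm_nonneg (z - 1)]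
      rw [hevalz, hnorm1]
      calc ‖∑ n ∈ Finset.range (x + 1), z ^ (s n)‖
          ≤ ∑ n ∈ Finset.range (x + 1), (1 + ‖z - 1‖) ^ (s n) := by
            refine (norm_sum_le _ _).trans (Finset.sum_le_sum fun n _ => ?_)
            rw [norm_pow]
            exact pow_le_pow_left₀ (norm_nonneg _) hz1 _
        _ ≤ ((x : ℝ) + 1) * Real.exp (B * (1 + ‖z - 1‖) * Real.log (Real.log x) +
              B * (1 + ‖z - 1‖) ^ (3 / 2 : ℝ)) := hrank x hx3 _ hy
        _ = ((x : ℝ) + 1) * Real.exp (B * Real.log (Real.log x) * (1 + ‖z - 1‖) +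
              B * (1 + ‖z - 1‖) ^ (3 / 2 : ℝ)) := by ring_nf
    -- Jensen at the free centre
    have hΛ' : 0 ≤ B * Real.log (Real.log x) := mul_nonneg hB0 hLpos.le
    obtain ⟨hfree, hnear, hfar⟩ := stub_jensenCount P (Real.log (Real.log x))
      (B * Real.log (Real.log x)) (Real.log (Real.log x) / C) A B hP1 hLpos.le hΛ' hR₁ hA0 hB0
      hdisc hglob
    -- Stieltjes conversion
    have hM0 : 0 ≤ Real.log (Real.log x) + B * Real.log (Real.log x) := add_nonneg hLpos.le hΛ'
    have hM : Real.log (Real.log x) + B * Real.log (Real.log x) ≤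
        (C + B * C) * (Real.log (Real.log x) / C) := by
      rw [mul_div_assoc', le_div_iff₀ hC]
      apply le_of_eq
      ring
    exact hK P.roots _ _ hM0 hR₁ hM hfree hnear hfar
  -- all x
  have hT0 : ∀ x : ℕ, 0 ≤ (((∑ n ∈ Finset.range (x + 1), (Polynomial.X : Polynomial ℂ) ^ (s n)).roots.map
      (fun ρ : ℂ => (‖(1 : ℂ) - ρ‖ ^ 2)⁻¹)).sum) := fun x => zoneSum_nonneg _
  exact bounded_of_eventually_bounded hT0 main

end Summit.Parity.BatemanHorn.Cruxes.SystemZeroRepulsion.NearFar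

end
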